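import Mathlib
import HarnessLib
import Summits.ValiantsHypothesis.ValiantsHypothesis.Theses.MonotoneRestoration
import Literature.Computability.AlgebraicComplexity.ArithCircuit
import Literature.Computability.AlgebraicComplexity.ArithCircuitProofs
import Literature.Computability.AlgebraicComplexity.MonotoneStructure
import Literature.Computability.AlgebraicComplexity.PermanentIrreducible
import Literature.ModelTheory.FiniteModelTheory.CkEquiv
import Summits.ValiantsHypothesis.ValiantsHypothesis.Theorems.MonotoneRestorationMonotoneRestorationQPCosetCount
import Summits.ValiantsHypothesis.ValiantsHypothesis.Theorems.MonotoneRestorationMonotoneRestorationQPSymmetricLB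
import Summits.ValiantsHypothesis.ValiantsHypothesis.Theorems.MonotoneRestorationMonotoneRestorationQPSupportSymmetrisation
import Summits.ValiantsHypothesis.ValiantsHypothesis.Theorems.MonotoneRestorationMonotoneRestorationQPSparseRegime
import Summits.ValiantsHypothesis.ValiantsHypothesis.Theorems.MonotoneRestorationMonotoneRestorationQPBeta
import Literature.Computability.AlgebraicComplexity.SymmetricArithCircuit
import Literature.Computability.AlgebraicComplexity.DawarWilsenach2025Proofs
import Literature.GroupTheory.PermutationGroups.SmallIndexSubgroups
import Summits.ValiantsHypothesis.ValiantsHypothesis.Theorems.MonotoneRestorationQP.Negative.LoadBearing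
import Summits.ValiantsHypothesis.ValiantsHypothesis.Theorems.MonotoneRestorationMonotoneRestorationQPPermSupportCount

/-! TTRL-lite variant V20082 of stmt-ValiantsHypothesis-15886

Target `stub_symmetricMonotone_choose_le_card`, move `lemma_proposal` (orbit-of-variables step):
in a `Sym_n`-symmetric labelled arithmetic circuit on the matrix of variables `x_ij` (diagonal
action), if some input gate reads `x_p` then for every `σ ∈ Sym_n` some input gate reads
`x_(σ p.1, σ p.2)` — the image of that gate under an automorphism extending `σ`.
See docs/architecture/ttrl-lite.md. -/

namespace Summit.ValiantsHypothesis.ValiantsHypothesis.Theorems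

open Summit.ValiantsHypothesis.ValiantsHypothesis.Theses.MonotoneRestoration
open Literature.Computability.AlgebraicComplexity

/-- **TTRL-lite variant V20082 of `stub_symmetricMonotone_choose_le_card`** (orbit of the variable
gates): in a `Sym_n`-symmetric labelled arithmetic circuit over `ℝ≥0` on the variables `x_ij`
(diagonal action of `Sym_n` on `Fin n × Fin n`), if a gate `g` is the input gate `x_p`, then for
every permutation `σ` there is a gate labelled `x_(σ p.1, σ p.2)`, namely `π g` for any circuit
automorphism `π` extending `σ` (Dawar–Wilsenach Def. 3.6–3.7: `label (π g) = σ • label g`).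
[cite: DawarWilsenach2025, Defs. 3.6–3.7] -/
theorem stub_symmetricMonotone_choose_le_card_var20082 :
    ∀ (n : ℕ) (G : Type) (C : LabelledArithCircuit NNReal (Fin n × Fin n) Unit G),
      C.IsSymmetric (Equiv.Perm (Fin n)) → ∀ (g : G) (p : Fin n × Fin n) (σ : Equiv.Perm (Fin n)),
      C.label g = CircuitLabel.var p → ∃ g' : G, C.label g' = CircuitLabel.var (σ p.1, σ p.2) := by
  intro n G C hC g p σ hg
  obtain ⟨π, hπ⟩ := hC σ
  refine ⟨π g, ?_⟩
  rw [hπ.label_apply, hg, CircuitLabel.smul_var]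
  rfl

end Summit.ValiantsHypothesis.ValiantsHypothesis.Theorems
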